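import Summits.ABC.ABC.Theses.DefiniteXi
import Summits.ABC.ABC.Theses.RibetTakahashiSplit
import Literature.NumberTheory.EllipticCurves.PastenHeightBoundsLemma68LocalProofs
import Literature.NumberTheory.EllipticCurves.PastenHeightBoundsLemma68Proofs
import Literature.NumberTheory.EllipticCurves.RationalIsogenyDegreesProofs
import Literature.NumberTheory.EllipticCurves.SemistableModPImageMultiplicativeProofs
import Literature.NumberTheory.EllipticCurves.KernelReductionTateFormTorsionProofs
import Literature.NumberTheory.EllipticCurves.Kato2004.TateModuleFilAtInertiaProofs
import Literature.NumberTheory.EllipticCurves.TorsionFilAtAdaptedBasisProofs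
import Literature.NumberTheory.EllipticCurves.TorsionFilAtCyclicOfOrdinaryPointProofs
import Literature.NumberTheory.EllipticCurves.SupersingularIrreducibleProofs
import Literature.NumberTheory.EllipticCurves.MazurTorsionGaloisStructureProofs
import Literature.NumberTheory.EllipticCurves.KodairaNeronUnramifiedInertiaProofs
import Literature.NumberTheory.EllipticCurves.WeilPairingCyclicComponentsDeterminantProofs
import HarnessLib

/-!
# Stub ideas k1 (gen 4) — `stub_pastenLemma68 : PastenShimura2024_lemma_6_8`
(crux `DefiniteRTControlPrime`, stmt-ABC-11338, route `DefiniteXi`; skeleton `Lines/Sketch.lean:79`)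
— FAMILY 1 (recognise & import).  Companion of `STUB-IDEAS-stub_pastenLemma68-1.md` (gen 4); supersedes nothing
in `StubIdeasK1G3PastenLemma68.lean` (gen 3: A0–A3, B1, B2, C1, C2′, C5, C9 PROVED; C2, C3, C4, C6, C7, C8, C0 open).

* §R RECOGNISE (PROVED): the stub IS item stmt-ABC-18928 (`Iff.rfl`); closes by name from the radius item
  stmt-ABC-15193 (R1) or the Mazur–Kenku fact (R2).
* §I the gen-4 delta — an IMPORT MAP for the one HARD shared helper of every Mazur-free re-cut, gen-3 `C4`
  («at `v ∣ p`: a cyclic `Λ ≤ E[p^e]`, inertia `= χ` on `Λ`, `= 1` on `E[p^e]/Λ`»).  The tree ALREADY has the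
  ordinary-place theory at level `p^k` under the name `torsionFilAt` (Howard's `Fil_v E[p^k]`, cell pub/bsd):
  `exists_generator_torsionFilAt_addOrderOf_eq`, `exists_addEquiv_mem_torsionFilAt_iff`,
  `exists_addEquiv_apply_eq_single_of_addOrderOf_eq`, `smul_sub_mem_localKernelOfReduction_of_mem_absInertia`,
  `Kato2004.tateModuleFilAt_inertia_ordinary_holds`, `hasIrreducibleModPGaloisRep_of_dvd_frobeniusTrace`,
  `inertia_eq_absInertia`, `exists_mem_inertia_apply_eq_holds`.  What is LEFT: I1 (3-line port, PROVED here),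
  I3 (PROVED here), I4 (S–M), I5 (M–L, = k1-163 g3 `exists_lambda_of_multiplicative_of_mem` VERBATIM — one port
  serves both stubs), I6 (S), I7 (S), C3 (S); then gen-3 C4 (restated as `C4_exists_line_at_p`) is glue.
-/

noncomputable section

-- `Summit.ABC.ABC` is the mandated summit-side namespace; the duplicate is deliberate.
set_option linter.dupNamespace false

open scoped Classical
open WeierstrassCurve IsDedekindDomain NumberField Field
open Literature.NumberTheory.EllipticCurves Literature.NumberTheory.EllipticCurves.ModularForms
open Literature.NumberTheory.GaloisRepresentations

namespace Summit.ABC.ABC.Cruxes.DefiniteRTControlPrime.StubIdeas1G4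

/-! ## §R  RECOGNISE — the stub is a route item, verbatim; closers by name -/

/-- **R0.** The stub's type IS the route item `DefiniteXi.IsogenyValuationTransport` (stmt-ABC-18928). -/
theorem R0_stub_iff_item :
    PastenShimura2024_lemma_6_8 ↔ Summit.ABC.ABC.Theses.DefiniteXi.IsogenyValuationTransport :=
  Iff.rfl

/-- **R1 (PROVED).** The stub from the route's radius item `DefiniteXi.MazurKenkuRadius` (stmt-ABC-15193):
cyclic companion of a degree-`≤ 163` isogeny + the Mazur-free cyclic transport `c_v(W)·b = c_v(W')·a`,
`ab ∣ deg`. [cite: PastenShimura2024, Lemma 6.8] -/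
theorem R1_stub_of_radius (hR : Summit.ABC.ABC.Theses.DefiniteXi.MazurKenkuRadius) :
    PastenShimura2024_lemma_6_8 := by
  intro W W' _ _ hiso v hv
  obtain ⟨φ, hB⟩ := hR W W' hiso
  have hv' : W'.HasMultiplicativeReductionAt v := hasMultiplicativeReductionAt_of_isIsogenous ⟨φ⟩ v hv
  obtain ⟨ψ, hcyc, hdvd⟩ := φ.exists_isCyclic_degree_dvd
  obtain ⟨a, b, ha, hb, hab, h⟩ :=
    exists_ordMinimalDiscriminant_mul_eq_mul_of_isCyclic ψ.degree ψ hcyc rfl v hv hv'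
  have habn : a * b ≤ 163 := (Nat.le_of_dvd φ.degree_pos (hab.trans hdvd)).trans hB
  refine ⟨a, b, ha, ?_, hb, ?_, h⟩
  · have : a ≤ a * b := Nat.le_mul_of_pos_right a hb
    omega
  · have : b ≤ a * b := Nat.le_mul_of_pos_left b ha
    omega

/-- **R1′ (PROVED).** Same from the `RibetTakahashiSplit` copy of the radius decl (ledger-deduplicated). -/
theorem R1'_stub_of_radius' (hR : Summit.ABC.ABC.Theses.RibetTakahashiSplit.MazurKenkuRadius) :
    PastenShimura2024_lemma_6_8 :=
  R1_stub_of_radius hR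

/-- **R2 (PROVED).** … or from the Mazur–Kenku named fact (tree one-liner). -/
theorem R2_stub_of_mazurKenku (hMK : mazurKenku_exists_cyclic_isogeny) : PastenShimura2024_lemma_6_8 :=
  PastenShimura2024_lemma_6_8_of_mazurKenku' hMK

/-! ## §I  IMPORT MAP for gen-3 `C4` (the line at `v ∣ p`)

Target (gen-3 `C4_exists_line_at_p`, restated at the end): `W/ℚ` globally minimal, `p` odd, `v ∣ p` semistable,
a `Γ_ℚ`-stable line in `E[p]` if `v` is good; then `∃ X ∈ E(ℚ̄)` of order `p^e` with `τ X = χ_{p^e}(τ) X` and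
`τ R − R ∈ ℤX` for all `τ ∈ I_𝔓`, `R ∈ E[p^e]`.  Pieces: GOOD ORDINARY `v`: I1 (quotient unramified, level `n`) +
I2 (tree: `Fil_v E[p^k]` cyclic of order `p^k`, adapted basis) + I3 (stable line ⇒ ordinary) + I4 (inertia `= χ` on
`Fil_v`) ; MULTIPLICATIVE `v`: I5 (Serre's `X` at level `p^e`) + I6 + C3 ; both: I7 (local inertia ↔ `I_𝔓 ≤ Γ_ℚ`). -/

section LocalFrame

variable {K : Type} [Field K] [NumberField K] (W : WeierstrassCurve K) [W.IsElliptic]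
  (v : HeightOneSpectrum (𝓞 K))

omit [W.IsElliptic] in
/-- **I1 (PROVED; the 3-line finite-level port of `absGaloisRestrict_smul_sub_mem_tateModuleFilAt`).**
At a place of GOOD reduction the inertia group of `Γ_{K_v}` moves `E[n]` into `Fil_v E[n]` — level `n` arbitrary,
no ordinarity (Silverman VII.4.1's displayed line, tree `smul_sub_mem_localKernelOfReduction_of_mem_absInertia`).
[cite: SilvermanAEC2009, VII.4 Thm. 4.1 (proof), VII.2 Prop. 2.1] -/
theorem I1_toLocal_sub_mem_torsionFilAt_of_mem_absInertia (hgood : W.HasGoodReductionAt v)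
    {τ : absoluteGaloisGroup (v.adicCompletion K)} (hτ : τ ∈ absInertia (v.adicCompletion K))
    (n : ℤ) (a : geomTorsion W n) :
    GaloisRep.toLocal v (W.torsionGaloisModule n) τ a - a ∈ W.torsionFilAt v n := by
  rw [mem_torsionFilAt_iff, AddSubgroupClass.coe_sub, map_sub, GaloisRep.toLocal_apply,
    torsionGaloisModule_apply_apply, AddSubgroup.torsionBy.coe_smul, ← resGal_eq_absGaloisRestrict, resGal_eq,
    pointsMapOfEmb_smul]
  exact W.smul_sub_mem_localKernelOfReduction_of_mem_absInertia hgood hτ _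

/-- **I2 (TREE, by name).** `Fil_v E[p^j]` is cyclic of order exactly `p^j` at a good place `v ∋ p` with an ordinary
point (`exists_generator_torsionFilAt_addOrderOf_eq`; adapted basis `exists_addEquiv_mem_torsionFilAt_iff`; the
ordinary point from `p ∤ a_v`: `exists_ordinaryPoint_local_of_not_dvd_frobeniusTraceAt`). Nothing to port. -/
theorem I2_exists_generator_torsionFilAt {p : ℕ} [Fact p.Prime] (hgood : W.HasGoodReductionAt v)
    (hpv : (p : 𝓞 K) ∈ v.asIdeal)
    (hord : ∃ P : localPoints W (v.adicCompletion K), (p : ℤ) • P = 0 ∧ P ∉ W.localKernelOfReduction v)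
    (j : ℕ) :
    ∃ P : geomTorsion W ((p : ℤ) ^ j), P ∈ W.torsionFilAt v ((p : ℤ) ^ j) ∧ addOrderOf P = p ^ j ∧
      ∀ Q ∈ W.torsionFilAt v ((p : ℤ) ^ j), ∃ c : ℕ, Q = c • P :=
  W.exists_generator_torsionFilAt_addOrderOf_eq v hgood hpv hord j

/-- **I4 (S–M).** Inertia acts on `Fil_v E[p^k]` through `χ_cyc mod p^k` (good place `v ∋ p` with an ordinary point).
Two routes: (a) over `ℚ`, project clause (2) of the LANDED `Kato2004.tateModuleFilAt_inertia_ordinary_holds`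
(`F⁺_v T_p ↠ Fil_v E[p^k]`: `T_p(Ê) ↠ Ê[p^k]`, tree `LocalPointsOrdinaryKernelDivisibleProofs`); (b) any `K`: adapted
basis `e` (I2) + I1 make every inertia element triangular `((a, y), (0, 1))`, and the Weil pairing (C3 below, local
or after I7) gives `a = χ(τ)`. [cite: GreenbergLNM1716, §2] [cite: SilvermanAEC2009, III.8 Prop. 8.3] -/
theorem I4_toLocal_eq_cyclotomic_smul_of_mem_torsionFilAt {p : ℕ} [Fact p.Prime]
    (hgood : W.HasGoodReductionAt v) (hpv : (p : 𝓞 K) ∈ v.asIdeal)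
    (hord : ∃ P : localPoints W (v.adicCompletion K), (p : ℤ) • P = 0 ∧ P ∉ W.localKernelOfReduction v)
    {k : ℕ} (hk : 1 ≤ k) {τ : absoluteGaloisGroup (v.adicCompletion K)}
    (hτ : τ ∈ absInertia (v.adicCompletion K)) {a : geomTorsion W ((p : ℤ) ^ k)}
    (ha : a ∈ W.torsionFilAt v ((p : ℤ) ^ k)) :
    GaloisRep.toLocal v (W.torsionGaloisModule ((p : ℤ) ^ k)) τ a =
      (PadicInt.toZModPow k
        ((GaloisRep.cyclotomicCharacter (v.adicCompletion K) p τ : ℤ_[p]ˣ) : ℤ_[p])).val • a := by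
  sorry

/-- **I7 (S; globalisation template = the last 12 lines of `exists_addSubgroup_card_le_of_hasMultiplicativeReductionAt`
/ `exists_line_of_not_dvd_frobeniusTrace_of_mem_primesAbove`).** Every `τ` in the inertia group `I_𝔓 ≤ Γ_K` of a
prime `𝔓 ∣ v` acts on each `E[n]`, up to ONE conjugation `g` (moving `𝔓` to the prime cut out by the chosen embedding
`K̄ → K̄_v`), as some `σ` of the LOCAL inertia group through `GaloisRep.toLocal v` (tree:
`exists_smul_eq_of_mem_primesAbove_holds`, `exists_mem_inertia_apply_eq_holds`, `inertia_eq_absInertia`,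
`resGalOfEmb_eq_of_apply_eq`). This carries I1/I2/I4/I5 to the frame of gen-3 C2/C5 (`𝔓.inertia (absoluteGaloisGroup ℚ)`).
[cite: NeukirchANT1999, Ch. II (9.3), (9.6)] -/
theorem I7_exists_absInertia_of_mem_inertia {𝔓 : Ideal (absIntegers (𝓞 K) K)} (h𝔓 : 𝔓 ∈ v.primesAbove) :
    ∃ g : absoluteGaloisGroup K, ∀ τ ∈ 𝔓.inertia (absoluteGaloisGroup K),
      ∃ σ ∈ absInertia (v.adicCompletion K), ∀ (n : ℤ) (a : geomTorsion W n),
        GaloisRep.toLocal v (W.torsionGaloisModule n) σ a = (g⁻¹ * τ * g) • a := by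
  sorry

end LocalFrame

/-- **I3 (PROVED; stable line ⇒ ordinary).** For `W/ℚ` globally minimal, `p` odd of good reduction: a
`Γ_ℚ`-stable line in `E[p]` forces `p ∤ a_p` — contrapositive of the LANDED Serre §1.11 Prop. 12
(`hasIrreducibleModPGaloisRep_of_dvd_frobeniusTrace`). Supplies I2/I4's ordinary point
(`exists_ordinaryPoint_local_of_not_dvd_frobeniusTraceAt` + `frobeniusTraceAt_eq_frobeniusTrace`).
[cite: SerreInventiones1972, §1.11 Prop. 12] -/
theorem I3_not_dvd_frobeniusTrace_of_stableLine (W : WeierstrassCurve ℚ) [W.IsElliptic] [W.IsGloballyMinimal]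
    (p : ℕ) [Fact p.Prime] (hp2 : p ≠ 2) (hΔ : ¬ (p : ℤ) ∣ minimalDiscriminantInt W)
    {P : geomTorsion W (p : ℤ)} (hP0 : P ≠ 0)
    (hst : ∀ σ : absoluteGaloisGroup ℚ, σ • P ∈ AddSubgroup.zmultiples P) :
    ¬ (p : ℤ) ∣ W.frobeniusTrace p := by
  have hp : p.Prime := Fact.out
  intro hss
  have hirr := hasIrreducibleModPGaloisRep_of_dvd_frobeniusTrace W p hp2 hΔ hss
  have hstab : ∀ σ : absoluteGaloisGroup ℚ, ∀ Q ∈ AddSubgroup.zmultiples P,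
      σ • Q ∈ AddSubgroup.zmultiples P := by
    intro σ Q hQ
    obtain ⟨k, rfl⟩ := AddSubgroup.mem_zmultiples_iff.mp hQ
    rw [← DistribMulAction.toAddMonoidHom_apply, map_zsmul, DistribMulAction.toAddMonoidHom_apply]
    exact AddSubgroup.zsmul_mem _ (hst σ) k
  rcases hirr (AddSubgroup.zmultiples P) hstab with h | h
  · exact hP0 ((AddSubgroup.eq_bot_iff_forall _).mp h P (AddSubgroup.mem_zmultiples P))
  · have hcard : Nat.card (AddSubgroup.zmultiples P) = Nat.card (geomTorsion W (p : ℕ)) := by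
      rw [h, AddSubgroup.card_top]
    rw [Nat.card_zmultiples, addOrderOf_eq_of_ne_zero W p hP0,
      Literature.NumberTheory.EllipticCurves.natCard_geomTorsion W p, sq] at hcard
    exact absurd (mul_right_cancel₀ hp.ne_zero ((one_mul p).trans hcard)) hp.one_lt.ne

/-- **I5 (M–L; = k1-163 gen-3 `exists_lambda_of_multiplicative_of_mem` VERBATIM — one port serves both stubs).**
Multiplicative `v ∣ ℓ`, `ℓ ≠ 2`, level `ℓᵏ`: port of the LANDED level-`ℓ` theorem
`exists_addSubgroup_card_le_of_hasMultiplicativeReductionAt` (`p ↦ ℓᵏ`): `Λ` = the `ℓᵏ`-torsion reducing to `O` in the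
`𝒪_w`-model of the Tate form of invariant `j`; in its ~200-line proof only the two closing steps change —
`TateForm.card_addSubgroup_le_pow … 1 G` is applied to `G = Ψ(Λ ⊓ E[ℓ])` (unchanged) and
`TateForm.one_lt_valuation_of_map_sub_eq_some_of_zsmul_eq_zero` is fed `hPm : ((ℓ ^ k : ℕ) : ℤ) • P = 0` (it is
already stated for prime POWERS `{m : ℕ}`; delete the `pow_one`). [cite: SerreInventiones1972, §1.12 Cor. of Prop. 13; §5.4 Lemme 6]
[cite: SilvermanATAEC1994, V.3–V.4] -/
theorem I5_exists_lambda_of_multiplicative_of_mem (W : WeierstrassCurve ℚ) [W.IsElliptic]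
    (ℓ k : ℕ) [Fact ℓ.Prime] (hℓ2 : ℓ ≠ 2) {v : HeightOneSpectrum (𝓞 ℚ)}
    (hℓv : (ℓ : 𝓞 ℚ) ∈ v.asIdeal) (hmult : W.HasMultiplicativeReductionAt v)
    {𝔓 : Ideal (absIntegers (𝓞 ℚ) ℚ)} (h𝔓 : 𝔓 ∈ v.primesAbove) :
    ∃ Λ : AddSubgroup (geomPoints W), Λ ≤ geomTorsion W ((ℓ : ℤ) ^ k) ∧
      Set.ncard {x : geomPoints W | x ∈ Λ ∧ (ℓ : ℤ) • x = 0} ≤ ℓ ∧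
      ∀ τ ∈ 𝔓.inertia (absoluteGaloisGroup ℚ), ∀ P ∈ geomTorsion W ((ℓ : ℤ) ^ k),
        τ • P - P ∈ Λ := by
  sorry

/-- **I6 (S; lattice algebra in `(ℤ/p^j)²`).** A non-zero vector is `p^s` times a vector of order `p^j` — so the
cyclic `Λ` of I5 (`#Λ[ℓ] ≤ ℓ`) sits inside `ℤ g₁` with `g₁` of order `ℓᵏ`, which
`exists_addEquiv_apply_eq_single_of_addOrderOf_eq` (tree) completes to a basis `(g₁, g₂)` of `E[ℓᵏ]`
(`nonempty_geomTorsion_prime_pow_addEquiv_fin_two`); inertia is then triangular in it (I5). [folklore] -/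
theorem I6_exists_eq_pow_smul_of_ne_zero {p : ℕ} [Fact p.Prime] {j : ℕ} (hj : 1 ≤ j)
    (x : Fin 2 → ZMod (p ^ j)) (hx : x ≠ 0) :
    ∃ (s : ℕ) (g : Fin 2 → ZMod (p ^ j)), s < j ∧ addOrderOf g = p ^ j ∧ x = (p ^ s) • g := by
  sorry

/-- **C3 (S; triangular determinant — gen-3 C3, restated).** The Weil-pairing computation of the LANDED
`intCast_mul_eq_modNCyclotomicCharacter_of_smul_eq_zsmul` with `σ g₂ = g₂ + y g₁` in place of `σ g₂ = a₂ g₂`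
(alternation `e_m(g₁, g₁) = 1`): `a₁ = χ_m(σ)`. Turns the triangular shape of I1+I2 / I5+I6 into «inertia `= χ` on the
line». [cite: SilvermanAEC2009, III.8 Prop. 8.1] -/
theorem C3_intCast_eq_cyclotomic_of_triangular (W : WeierstrassCurve ℚ) [W.IsElliptic] (m : ℕ)
    [NeZero m] (hm : 2 ≤ m) {g₁ g₂ : geomTorsion W (m : ℤ)}
    (hspan : ∀ T : geomTorsion W (m : ℤ), ∃ c₁ c₂ : ℤ, T = c₁ • g₁ + c₂ • g₂)
    (ho₂ : addOrderOf g₂ = m) (σ : absoluteGaloisGroup ℚ) {a₁ y : ℤ} (ha₁ : σ • g₁ = a₁ • g₁)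
    (ha₂ : σ • g₂ = g₂ + y • g₁) :
    ((a₁ : ℤ) : ZMod m) = ((modNCyclotomicCharacter ℚ m σ : (ZMod m)ˣ) : ZMod m) := by
  sorry

/-- **C4 (= gen-3 `C4_exists_line_at_p`; GLUE once I1–I7, C3 are in).** Good `v`: I3 ⇒ ordinary point ⇒ I2 gives
`X` (generator of `Fil_v E[p^e]`, order `p^e`), I1 the quotient clause, I4 (or C3) the character, I7 the frame.
Multiplicative `v`: I5 gives `Λ`, I6 puts `Λ ≤ ℤX` with `X` of order `p^e` and a basis `(X, g₂)`, inertia is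
triangular, C3 gives the character. [cite: SilvermanATAEC1994, V.3–V.5] [cite: GreenbergLNM1716, §2] -/
theorem C4_exists_line_at_p (W : WeierstrassCurve ℚ) [W.IsElliptic] [W.IsGloballyMinimal]
    {p : ℕ} [Fact p.Prime] (hp2 : p ≠ 2) (e : ℕ) (he : 0 < e) [NeZero (p ^ e)]
    {v : HeightOneSpectrum (𝓞 ℚ)} (hpv : (p : 𝓞 ℚ) ∈ v.asIdeal)
    (hss : W.HasGoodReductionAt v ∨ W.HasMultiplicativeReductionAt v)
    (hline : ∃ P : geomPoints W, addOrderOf P = p ∧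
      ∀ σ : absoluteGaloisGroup ℚ, σ • P ∈ AddSubgroup.zmultiples P)
    {𝔓 : Ideal (absIntegers (𝓞 ℚ) ℚ)} (h𝔓 : 𝔓 ∈ v.primesAbove) :
    ∃ X : geomPoints W, addOrderOf X = p ^ e ∧
      (∀ τ ∈ 𝔓.inertia (absoluteGaloisGroup ℚ),
        τ • X = ((modNCyclotomicCharacter ℚ (p ^ e) τ : (ZMod (p ^ e))ˣ) : ZMod (p ^ e)).val • X) ∧
      ∀ τ ∈ 𝔓.inertia (absoluteGaloisGroup ℚ), ∀ R : geomPoints W,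
        ((p ^ e : ℕ) : ℤ) • R = 0 → τ • R - R ∈ AddSubgroup.zmultiples X := by
  sorry

/-! ## Sanity (in-Lean): the tree's level-`p^m` engines are stated for prime POWERS already -/

example := @TateForm.one_lt_valuation_of_map_sub_eq_some_of_zsmul_eq_zero
example := @TateForm.card_addSubgroup_le_pow
example := @exists_addEquiv_apply_eq_single_of_addOrderOf_eq
example : Kato2004.tateModuleFilAt_inertia_ordinary := Kato2004.tateModuleFilAt_inertia_ordinary_holds

end Summit.ABC.ABC.Cruxes.DefiniteRTControlPrime.StubIdeas1G4

end
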